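import Summits.HodgeConjecture.HodgeConjecture.Theorems.R90S1BranchBDeterminantRootsRamified                 -- ★ (this seat) Z4-ram `det_eq_zero_iff_of_norm_lt_one_ram`
import Summits.HodgeConjecture.HodgeConjecture.Theorems.R90S1KeysThmTwoDepthZeroBranchBConversionRamified    -- ★ (this seat) Z5-ram `exists_eta_of_branchB_of_apply_norm_uniformizer_ramified`
import Literature.NumberTheory.Automorphic.HeisenbergStrataMeasureRamified                                    -- ★ `unitModulusChar_eq_inv_absNorm_of_valued_eq` (`‖u‖ = (N𝔓_w)⁻¹` for `|u_w| = exp(−1)`)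
import Mathlib.NumberTheory.NumberField.Completion.FinitePlace                                                -- `NumberField.HeightOneSpectrum.one_lt_absNorm`
import HarnessLib

/-!
# R90 · S1 ∕ U4Keys leaf (U4f-χ₁-ram-one-d0B) — THE END ASSEMBLY FROM `det M = 0` AT A RAMIFIED PLACE: the four Casselman-pair entries + `det M = 0` ⟹ `X = χ₁(NΠ) = 1∕q`
# ⟹ `χ₁ = η·‖·‖^{1∕2}`, `η|_{F^×} = ω_{E∕F}` — the SECOND DISJUNCT of :155  [Keys1984 §7 Thm (2) (d); Casselman1980 §3; PAPER-Z3-DepthZeroRamified §1–§2]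

Cell `hodgecm-mathlib`, SLAB R90-TF, section S1 «Ch. 12 local», crux H413 = `stmt-HodgeConjecture-24833` (lane `--supports … --as helper`), route HCCMUnconditional; prover seat
`hodgecm-mathlib-R90-C10-p05` (g0); socket of record S1#3′ = K2E3 leaf (U4f-χ₁-ram-one) ⊇ U4Keys :155 (depth 0, Branch B).  THEOREMS ONLY (no definition ∕ instance ∕ notation ∕
named fact ∕ `sorry`); ★-only imports.  The RAMIFIED twin of ★ `K2E3KeysThmTwoDepthZeroBranchBFromDet.exists_eta_of_det_eq_zero_of_pairEntries` (inert, frame-free §1) — so that the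
ramified d0B chain lacks ONLY its measure-theoretic middle (Z2-B-ram type basis, Z3-ram cell functions + the two shell pieces), exactly as the inert chain did before (II)-a∕b∕c.

THE LETTERS (paper §1–§2, r01 junk-screen R-a∕R-e).  `q = N𝔓_w` (`= N𝔭_v` at a ramified place), `V = μ(N₀) ≠ 0`, a sign `c₀` (`= λ̄(−½)`, `c₀² = 1`),
`X := χ₁(σΠ·Π)` (`= λ(NΠ)q^{−2s}`; `|X| < 1` for contracting `χ₁` since `‖σΠ·Π‖ = q⁻² < 1`), and the four entries `Λ11 = Λ_1 f₁ = c₀·((q−1)∕q)·V·X∕(1−X)` (`G₁`),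
`Λww = Λ_{w₀} f_w = c₀·((q−1)∕q)·V∕(1−X)` (`G₂`), `Λw1 = Λ_1 f_w = V` (`vol N₀`), `Λ1w = Λ_{w₀} f₁ = q⁻¹·V` (`vol N(𝔭) = q⁻¹ vol N₀` — NOT `q⁻³`).
* §1 (frame-free algebra) `det_letters_eq_ram` (`Λ11·Λww − Λw1·Λ1w = V²·((q−1)²q⁻²X∕(1−X)² − q⁻¹)`), **`eq_inv_of_det_eq_zero_ram`** (`det M = 0`, `V ≠ 0`, `|X| < 1 < q` ⟹ `X = q⁻¹`, ★ Z4-ram).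
* §2 (CM, place letters only) `coe_halfModulusChar_norm_uniformizer` (`‖σΠ·Π‖^{1∕2} = (N𝔓_w)⁻¹` as a complex number) and **`exists_eta_of_det_eq_zero_of_pairEntries_ram`**: at a non-split
  RAMIFIED place with `|2|_w = 1`, `χ₁` continuous with `hdepth`, `hB`, `hram` (:155's letters), the four entries in the shapes above with `X = χ₁(σΠ·Π)`, `det M = 0` ⟹
  `∃ η, IsQuadraticCharExtension σ η ∧ Continuous η ∧ χ₁ = η · halfModulusChar` (§1 ⟹ `χ₁(σΠ·Π) = q⁻¹ = ‖σΠ·Π‖^{1∕2}` ⟹ ★ Z5-ram).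
HONEST LABEL: HC_CM is proved only modulo the 7 printed citations (2 remaining named inputs: hLiu418 = `stmt-HodgeConjecture-24832`, h413 = `stmt-HodgeConjecture-24833`) until rung 0
closes; count-neutral — NOT THE PAYER: `det M = 0` (from reducibility via the type vector) and the two big-cell entries at a ramified place remain to be typed (paper §3).

## References
* [Keys1984] D. Keys, *Principal series representations of special unitary groups over local fields*, Compositio Math. 51 (1984), §3, §7 Theorem (2) (d) p. 126.
* [Casselman1980] W. Casselman, *The unramified principal series of p-adic groups I*, Compositio Math. 40 (1980), §3.
* [Rogawski1990] J. D. Rogawski, *Automorphic Representations of Unitary Groups in Three Variables*, Ann. of Math. Stud. 123 (1990), §12.2 (1)–(2) p. 173.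
-/

set_option autoImplicit false
-- the mandated namespace has the single-problem summit's repeated segment (`HodgeConjecture.HodgeConjecture`)
set_option linter.dupNamespace false

noncomputable section

open NumberField IsDedekindDomain
open scoped NNReal
open Literature.NumberTheory.Automorphic Literature.NumberTheory.Automorphic.UnitaryGroup
open Summit.HodgeConjecture.HodgeConjecture.Cruxes.H413

namespace Summit.HodgeConjecture.HodgeConjecture.R90.S1

/-! ## §1 Frame-free algebra: the four ramified entries and the root -/

/-- **`det M` in the four ramified entries**: `Λ11·Λww − Λw1·Λ1w = V²·((q−1)²q⁻²·X∕(1−X)² − q⁻¹)` (`c₀² = 1`). [cite: Keys1984, §7 Theorem (2) (d) p. 126] [cite: Casselman1980, §3] -/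
theorem det_letters_eq_ram (q X c₀ V Λ11 Λ1w Λw1 Λww : ℂ) (hc : c₀ ^ 2 = 1)
    (h11 : Λ11 = c₀ * (((q - 1) / q) * V * X / (1 - X))) (hww : Λww = c₀ * (((q - 1) / q) * V / (1 - X)))
    (hw1 : Λw1 = V) (h1w : Λ1w = q⁻¹ * V) :
    Λ11 * Λww - Λw1 * Λ1w = V ^ 2 * ((q - 1) ^ 2 * (q ^ 2)⁻¹ * X * ((1 - X) ^ 2)⁻¹ - q⁻¹) := by
  rw [h11, hww, hw1, h1w]
  -- `ring` keeps `(1 − X)⁻¹`, `((1 − X)²)⁻¹` and `q⁻¹`, `(q²)⁻¹` as atoms: relate them once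
  have hX2 : (1 - X)⁻¹ * (1 - X)⁻¹ = ((1 - X) ^ 2)⁻¹ := by rw [← mul_inv, ← pow_two]
  have hq2 : q⁻¹ * q⁻¹ = (q ^ 2)⁻¹ := by rw [← mul_inv, ← pow_two]
  simp only [div_eq_mul_inv]
  linear_combination (((q - 1) ^ 2 * V ^ 2 * X) * (q⁻¹ * q⁻¹) * ((1 - X)⁻¹ * (1 - X)⁻¹)) * hc
    + ((q - 1) ^ 2 * V ^ 2 * X * (q⁻¹ * q⁻¹)) * hX2 + ((q - 1) ^ 2 * V ^ 2 * X * ((1 - X) ^ 2)⁻¹) * hq2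

/-- **THE ROOT FROM THE FOUR RAMIFIED ENTRIES**: for real `q > 1`, `|X| < 1`, `c₀² = 1`, `V ≠ 0` and the four entries as in `det_letters_eq_ram`, `det M = 0` forces **`X = q⁻¹`** (★ Z4-ram
`det_eq_zero_iff_of_norm_lt_one_ram` after dividing by `V²`).  In the d0B assembly: `q = N𝔓_w`, `X = χ₁(σΠ·Π)`, `V = μ(N₀) > 0`, `c₀ = λ̄(−½)`. [cite: Keys1984, §7 Theorem (2) (d) p. 126] [cite: Casselman1980, §3] -/
theorem eq_inv_of_det_eq_zero_ram (q : ℝ) (hq : 1 < q) (X c₀ V Λ11 Λ1w Λw1 Λww : ℂ) (hX : ‖X‖ < 1) (hc : c₀ ^ 2 = 1) (hV : V ≠ 0)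
    (h11 : Λ11 = c₀ * ((((q : ℂ) - 1) / (q : ℂ)) * V * X / (1 - X))) (hww : Λww = c₀ * ((((q : ℂ) - 1) / (q : ℂ)) * V / (1 - X)))
    (hw1 : Λw1 = V) (h1w : Λ1w = ((q : ℂ))⁻¹ * V)
    (hdet : Λ11 * Λww - Λw1 * Λ1w = 0) :
    X = ((q : ℂ))⁻¹ := by
  rw [det_letters_eq_ram (q : ℂ) X c₀ V Λ11 Λ1w Λw1 Λww hc h11 hww hw1 h1w] at hdet
  have h := (mul_eq_zero.1 hdet).resolve_left (pow_ne_zero 2 hV)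
  exact (det_eq_zero_iff_of_norm_lt_one_ram q hq X hX).1 h

/-! ## §2 On `E_v = Π_{w∣v} L_w` at a ramified place: `‖σΠ·Π‖^{1∕2} = (N𝔓_w)⁻¹`, and the end assembly -/

section CM

variable (L : Type) [Field L] [NumberField L] [IsCMField L] (v : HeightOneSpectrum (𝓞 ↥(maximalRealSubfield L)))
  (hns : ∀ w : PlacesOver L v, IsCMField.complexConj L • w.1 = w.1) (w : PlacesOver L v) (hw : IsCMField.complexConj L • w.1 = w.1)

include hns hw in
/-- **`‖σΠ·Π‖^{1∕2} = (N𝔓_w)⁻¹` as a complex number** for a uniformiser unit `Π` of `E_v` (`|Π_w| = exp(−1)`; `‖σΠ‖ = ‖Π‖ = (N𝔓_w)⁻¹` by ★ `unitModulusChar_eq_inv_absNorm_of_valued_eq` and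
★ `valued_conjLocal_apply_of_smul_eq`). [cite: NeukirchANT1999, Ch. II §4 Prop. (4.3)] -/
theorem coe_halfModulusChar_norm_uniformizer (piU : (LocalRing L v)ˣ) (hpiU : ∀ w' : PlacesOver L v, Valued.v ((piU : LocalRing L v) w') = WithZero.exp (-1 : ℤ)) :
    ((halfModulusChar (LocalRing L v) (Units.map (conjLocal L (IsCMField.complexConj L) v : LocalRing L v →* LocalRing L v) piU * piU) : ℂˣ) : ℂ) =
      ((Ideal.absNorm w.1.asIdeal : ℂ))⁻¹ := by
  have hσ : Valued.v (((Units.map (conjLocal L (IsCMField.complexConj L) v : LocalRing L v →* LocalRing L v) piU : (LocalRing L v)ˣ) : LocalRing L v) w) =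
      WithZero.exp (-1 : ℤ) := by
    rw [Units.coe_map, MonoidHom.coe_coe, valued_conjLocal_apply_of_smul_eq L v w (hns w) (piU : LocalRing L v)]
    exact hpiU w
  have hmod : unitModulusChar (LocalRing L v) (Units.map (conjLocal L (IsCMField.complexConj L) v : LocalRing L v →* LocalRing L v) piU * piU) =
      (((Ideal.absNorm w.1.asIdeal : ℝ≥0))⁻¹) ^ 2 := by
    rw [map_mul, unitModulusChar_eq_inv_absNorm_of_valued_eq L v w hw _ hσ, unitModulusChar_eq_inv_absNorm_of_valued_eq L v w hw piU (hpiU w), pow_two]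
  rw [coe_halfModulusChar_apply, hmod, NNReal.sqrt_sq, NNReal.coe_inv, NNReal.coe_natCast, Complex.ofReal_inv, Complex.ofReal_natCast]

include hns hw in
/-- **THE END ASSEMBLY FROM `det M = 0` AT A RAMIFIED PLACE.**  `v` non-split, `w ∣ v` ramified (`he`), `|2|_w = 1`; `Π` a uniformiser unit; `χ₁` continuous with :155's letters
`hdepth`, `hB`, `hram`; letters `V ≠ 0`, `c₀² = 1`; `X = χ₁(σΠ·Π)` with `|X| < 1`; `q = N𝔓_w`; four complex numbers `Λ11 = c₀·((q−1)∕q)·V·X∕(1−X)`, `Λww = c₀·((q−1)∕q)·V∕(1−X)`,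
`Λw1 = V`, `Λ1w = q⁻¹·V` (PAPER-Z3-Ramified §1: `G₁, G₂, vol N₀, vol N(𝔭)`) with `Λ11·Λww − Λw1·Λ1w = 0` (§2: `det M = 0`).  Then **`χ₁ = η · ‖·‖^{1∕2}` for a continuous quadratic
character extension `η`** (the second disjunct of :155): §1 gives `X = q⁻¹ = ‖σΠ·Π‖^{1∕2}`, ★ Z5-ram converts. [cite: Keys1984, §7 Theorem (2) (d) p. 126] [cite: Casselman1980, §3]
[cite: Rogawski1990, §12.2 (1)–(2) p. 173] -/
theorem exists_eta_of_det_eq_zero_of_pairEntries_ram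
    (he : v.asIdeal.ramificationIdx' w.1.asIdeal ≠ 1) (h2w : Valued.v (2 : w.1.adicCompletion L) = 1)
    (piU : (LocalRing L v)ˣ) (hpiU : ∀ w' : PlacesOver L v, Valued.v ((piU : LocalRing L v) w') = WithZero.exp (-1 : ℤ))
    (χ₁ : (LocalRing L v)ˣ →* ℂˣ) (h₁ : Continuous (fun x => ((χ₁ x : ℂˣ) : ℂ)))
    (hdepth : ∀ u : (LocalRing L v)ˣ, (∀ w' : PlacesOver L v, Valued.v (((u : LocalRing L v) w') - 1) < 1) → χ₁ u = 1)
    (hB : ∀ u : (LocalRing L v)ˣ, (∀ w' : PlacesOver L v, Valued.v ((u : LocalRing L v) w') = 1) →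
      χ₁ (u * Units.map (conjLocal L (IsCMField.complexConj L) v : LocalRing L v →* LocalRing L v) u) = 1)
    (hram : ¬ ∀ u ∈ (Submonoid.pi Set.univ (fun w' : PlacesOver L v => (w'.1.adicCompletionIntegers L).toSubring.toSubmonoid)).units, χ₁ u = 1)
    (V c₀ Λ11 Λ1w Λw1 Λww : ℂ) (hV : V ≠ 0) (hc : c₀ ^ 2 = 1)
    (hX : ‖((χ₁ (Units.map (conjLocal L (IsCMField.complexConj L) v : LocalRing L v →* LocalRing L v) piU * piU) : ℂˣ) : ℂ)‖ < 1)
    (h11v : Λ11 = c₀ * ((((Ideal.absNorm w.1.asIdeal : ℝ) : ℂ) - 1) / ((Ideal.absNorm w.1.asIdeal : ℝ) : ℂ) * V *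
      ((χ₁ (Units.map (conjLocal L (IsCMField.complexConj L) v : LocalRing L v →* LocalRing L v) piU * piU) : ℂˣ) : ℂ) /
        (1 - ((χ₁ (Units.map (conjLocal L (IsCMField.complexConj L) v : LocalRing L v →* LocalRing L v) piU * piU) : ℂˣ) : ℂ))))
    (hwwv : Λww = c₀ * ((((Ideal.absNorm w.1.asIdeal : ℝ) : ℂ) - 1) / ((Ideal.absNorm w.1.asIdeal : ℝ) : ℂ) * V /
      (1 - ((χ₁ (Units.map (conjLocal L (IsCMField.complexConj L) v : LocalRing L v →* LocalRing L v) piU * piU) : ℂˣ) : ℂ))))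
    (hw1v : Λw1 = V) (h1wv : Λ1w = (((Ideal.absNorm w.1.asIdeal : ℝ) : ℂ))⁻¹ * V)
    (hdet : Λ11 * Λww - Λw1 * Λ1w = 0) :
    ∃ η : (LocalRing L v)ˣ →* ℂˣ, IsQuadraticCharExtension (conjLocal L (IsCMField.complexConj L) v) η ∧
      Continuous (fun x => ((η x : ℂˣ) : ℂ)) ∧ χ₁ = η * halfModulusChar (LocalRing L v) := by
  have hq : (1 : ℝ) < (Ideal.absNorm w.1.asIdeal : ℝ) := by exact_mod_cast NumberField.HeightOneSpectrum.one_lt_absNorm w.1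
  have hroot0 := eq_inv_of_det_eq_zero_ram (Ideal.absNorm w.1.asIdeal : ℝ) hq _ c₀ V Λ11 Λ1w Λw1 Λww hX hc hV h11v hwwv hw1v h1wv hdet
  rw [Complex.ofReal_natCast] at hroot0
  have hroot : χ₁ (Units.map (conjLocal L (IsCMField.complexConj L) v : LocalRing L v →* LocalRing L v) piU * piU) =
      halfModulusChar (LocalRing L v) (Units.map (conjLocal L (IsCMField.complexConj L) v : LocalRing L v →* LocalRing L v) piU * piU) :=
    Units.ext (by rw [hroot0, coe_halfModulusChar_norm_uniformizer L v hns w hw piU hpiU])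
  exact exists_eta_of_branchB_of_apply_norm_uniformizer_ramified L v hns w hw he h2w piU hpiU χ₁ h₁ hdepth hB hram hroot

end CM

end Summit.HodgeConjecture.HodgeConjecture.R90.S1

end
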